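import Mathlib

/-!
# Solo-blind O1b, E76: first-order algebra of the reducible Eisenstein line (THEOREM G-nec)

Ring-theoretic kernel of THEOREM G-nec of the solo-blind Eisenstein study (`paper/theoremPhi.md`
§5(q)).  There the pseudo-representation of the local Hecke algebra `T` is, modulo a reducible
hyperplane `I' ⊂ I` of the Eisenstein ideal, a sum `χ₁ + ε χ₁⁻¹` with `χ₁ = 1 + δ`, where `δ` takes
values in the line `I/I'`, so that `δ² = 0` and `ℓ · δ = 0`.  The five statements below are exactly the
local computations of that proof, in an arbitrary commutative ring with an element `d` of square
zero:
* E76a (inverse) `(1 + d)(1 - d) = 1`;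
* E76b (VALUE LAW at a good prime `p`) `χ₁(p) + p χ₁(p)⁻¹ - (p + 1) = (1 - p) d`, i.e.
  `η_p ≡ (1 - p) ψ(p) x̄`;
* E76c (SELECTION RULE at a Steinberg prime with `ω ≠ 1`): the Steinberg trace condition
  `(χ₁(g) - 1)(χ₁(g) - ε(g)) = 0` with `1 - ε(g)` a unit forces `d = 0`;
* E76d (NO CONDITION at a prime `q ≡ 1 (mod ℓ)`): if `ℓ d = 0` and `1 - ε(g) ∈ ℓ A` the same
  condition holds automatically;
* E76e (the case `p = ℓ`, from ordinarity `T_ℓ = α + ℓ α⁻¹`, `α = χ₁(Frob_ℓ) = 1 + d`):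
  `η_ℓ = d`.
-/

namespace Summit.Langlands.Langlands.Theorems

/-- **E76a.** A first-order unit: if `d * d = 0` then `(1 + d) * (1 - d) = 1`. -/
theorem soloBlind_firstOrder_inv {A : Type*} [CommRing A] {d : A} (hd : d * d = 0) :
    (1 + d) * (1 - d) = 1 := by
  linear_combination (-1 : A) * hd

/-- **E76b (value law).** With `χ₁ = 1 + d`, `χ₁⁻¹ = 1 - d`: the Hecke eigenvalue of the reducible
first-order deformation minus the Eisenstein value is `(1 - p) * d`. -/
theorem soloBlind_firstOrder_value (A : Type*) [CommRing A] (d p : A) :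
    (1 + d) + p * (1 - d) - (p + 1) = (1 - p) * d := by
  ring

/-- **E76c (selection rule).** If `d * d = 0`, the Steinberg trace condition
`d * (1 + d - e) = 0` (that is `(χ₁ - 1)(χ₁ - ε) = 0` with `χ₁ = 1 + d`, `ε = e`) and `1 - e` is a
unit (residually `ω(g) ≠ 1`), then `d = 0`. -/
theorem soloBlind_firstOrder_selection {A : Type*} [CommRing A] {d e : A} (hd : d * d = 0)
    (hst : d * (1 + d - e) = 0) (hu : IsUnit (1 - e)) : d = 0 := by
  have h1 : d * (1 - e) = 0 := by
    linear_combination hst - hd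
  obtain ⟨u, hu'⟩ := hu
  have h2 : d * (u : A) = 0 := by rw [hu']; exact h1
  have h3 : d * (u : A) * (↑u⁻¹ : A) = 0 := by rw [h2, zero_mul]
  simpa [mul_assoc] using h3

/-- **E76d (no first-order condition at `q ≡ 1 (mod ℓ)`).** If `d * d = 0`, `l * d = 0` and
`1 - e = l * c`, then the Steinberg trace condition `d * (1 + d - e) = 0` holds automatically. -/
theorem soloBlind_firstOrder_noCondition {A : Type*} [CommRing A] {d e l c : A} (hd : d * d = 0)
    (hl : l * d = 0) (he : 1 - e = l * c) : d * (1 + d - e) = 0 := by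
  have : d * (1 + d - e) = d * d + d * (1 - e) := by ring
  rw [this, hd, he, zero_add]
  linear_combination c * hl

/-- **E76e (the prime `p = ℓ`).** If `d * d = 0` and `l * d = 0`, then with `α = 1 + d`
(so `α⁻¹ = 1 - d`) the ordinary Hecke eigenvalue `T_ℓ = α + l α⁻¹` satisfies
`T_ℓ - l - 1 = d` (`= (1 - l) d`): the value law extends to `p = ℓ`. -/
theorem soloBlind_firstOrder_value_at_ell {A : Type*} [CommRing A] {d l : A}
    (hl : l * d = 0) : ((1 + d) + l * (1 - d)) - l - 1 = d ∧ (1 - l) * d = d := by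
  constructor
  · linear_combination (-1 : A) * hl
  · linear_combination (-1 : A) * hl

end Summit.Langlands.Langlands.Theorems
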